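import Mathlib
import Summits.RiemannHypothesis.RiemannHypothesis.Theorems.IntegerScrewRootFlow
import Summits.RiemannHypothesis.RiemannHypothesis.Theorems.IntegerScrewMinFacSums
import Summits.RiemannHypothesis.RiemannHypothesis.Theorems.IntegerScrewPathUsers
import HarnessLib

/-!
# Route `IntegerScrew` — PROPOSITION K: the root functional of every atom is `O(log R·log log R)·D`, i.e. the
# dominant cells of the window law are `O(log log R)` (CONTINUUM-LIMIT §24.11, §26.6)

`IntegerScrewRootFlow.root_functional_sq_le` bounds the root functional of the atom `𝒜 = {x ≤ R : x p-smooth}` by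
`E_R·D_𝒜(g)` with the explicit energy `E_R = Σ_{2≤y≤R} π_y²/(y·log minFac y)`, `π_y = Π_{q≤minFac y}(1 − 1/q)⁻¹`,
and `IntegerScrewMinFacSums.rootEnergy_le` bounds `E_R ≤ e¹⁰·(log R + log 4 + e⁵·log(R+1)·(log log R + 4))` by
elementary prime sums.  Together:

* **`propK`** — for `2 ≤ R`, every `p` and `g`:
  `(Σ_{x∈𝒜}(1/x)(g x − g 1))² ≤ e¹⁰·(log R + log 4 + e⁵·log(R+1)·(log log R + 4))·D_𝒜(g)`;
* **`subset_root_functional_sq_le`** — the same for an ARBITRARY user set `S ⊆ [1, R]` against `D_{Ω_R}(g)` (the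
  window tree and the legs `α`+`β` of PROP. K″, §27.2); `subset_root_functional_sq_le_smooth` — the same inside an
  atom `{x ≤ R : x N-smooth}` (K″ for the near-extreme cells `(p⁻, R, p)`, §27.2 (iii)).

In κ-units (`κ = (log R/H′²)·F²/D`, `H′ = Σ_𝒜 1/x ≥ log R − 1` on the dominant cells `R < 2p`) this is PROP. K of
CONTINUUM-LIMIT 24.11 with tree constants: **κ(dominant cell) ≤ e¹⁵(1 + o(1))·(log log R + 5)** — the growing part
of CONJECTURE W is `O(log log R)` in the kernel, summable against the weight `1/(p log p)`.  RH-free, elementary.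
Nothing in this file bears on the truth of RH.
References: CONTINUUM-LIMIT §24.11, §26.6 (rh-explicit A6-PIVOT); M. Suzuki, J. Lond. Math. Soc. (2) 108 (2023)
1448–1487 [Suzuki2023]; Hardy–Wright Thms 425, 427, 429 [HardyWright2008].
-/

noncomputable section

set_option linter.dupNamespace false -- D-0017: `Summit.<S>.<S>.…` is the designed namespace

namespace Summit.RiemannHypothesis.RiemannHypothesis.Theorems.IntegerScrew

open Finset Real
open ArithmeticFunction (vonMangoldt)

/-! ### PROPOSITION K -/

/-- **PROPOSITION K (CONTINUUM-LIMIT §24.11, kernel form with tree constants).**  For `2 ≤ R`, every `p` and every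
`g : ℕ → ℝ`, with `𝒜 = {x ≤ R : x p-smooth}`:
`(Σ_{x∈𝒜}(1/x)(g x − g 1))² ≤ e¹⁰·(log R + log 4 + e⁵·log(R+1)·(log log R + 4))·Σ_{x∈𝒜}(1/x)Σ_{n∣x}Λ(n)(g x − g(x/n))²`
— the root (dominant-cell) functional costs `O(log R·log log R)` Dirichlet units, i.e. `κ = O(log log R)`. -/
theorem propK {R : ℕ} (hR : 2 ≤ R) (p : ℕ) (g : ℕ → ℝ) :
    (∑ x ∈ (Icc 1 R).filter (· ∈ Nat.smoothNumbers p), (1 / (x : ℝ)) * (g x - g 1)) ^ 2 ≤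
      Real.exp 10 * (Real.log R + Real.log 4 + Real.exp 5 * Real.log ((R : ℝ) + 1) * (Real.log (Real.log R) + 4)) *
        ∑ x ∈ (Icc 1 R).filter (· ∈ Nat.smoothNumbers p),
          (1 / (x : ℝ)) * ∑ n ∈ x.divisors, (vonMangoldt n : ℝ) * (g x - g (x / n)) ^ 2 := by
  have h := root_functional_sq_le p R g
  have hD : 0 ≤ ∑ x ∈ (Icc 1 R).filter (· ∈ Nat.smoothNumbers p),
      (1 / (x : ℝ)) * ∑ n ∈ x.divisors, (vonMangoldt n : ℝ) * (g x - g (x / n)) ^ 2 :=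
    Finset.sum_nonneg fun x _ => mul_nonneg (by positivity)
      (Finset.sum_nonneg fun n _ => mul_nonneg ArithmeticFunction.vonMangoldt_nonneg (sq_nonneg _))
  exact h.trans (mul_le_mul_of_nonneg_right (rootEnergy_le hR) hD)

/-- **PROP. K for an arbitrary user set** (the window tree of PROP. K″ and its legs `α`+`β`, CONTINUUM-LIMIT §27.2):
for `2 ≤ R`, every `S ⊆ [1, R]` and `g`,
`(Σ_{x∈S}(1/x)(g x − g 1))² ≤ e¹⁰·(log R + log 4 + e⁵·log(R+1)·(log log R + 4))·D_{Ω_R}(g)`,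
`D_{Ω_R}(g) = Σ_{x≤R}(1/x)Σ_{n∣x}Λ(n)(g x − g(x/n))²` (tree flow from the root to `S`; loads `≤` the full tree loads). -/
theorem subset_root_functional_sq_le {R : ℕ} (hR : 2 ≤ R) {S : Finset ℕ} (hS : S ⊆ Icc 1 R) (g : ℕ → ℝ) :
    (∑ x ∈ S, (1 / (x : ℝ)) * (g x - g 1)) ^ 2 ≤
      Real.exp 10 * (Real.log R + Real.log 4 + Real.exp 5 * Real.log ((R : ℝ) + 1) * (Real.log (Real.log R) + 4)) *
        ∑ x ∈ Icc 1 R, (1 / (x : ℝ)) * ∑ n ∈ x.divisors, (vonMangoldt n : ℝ) * (g x - g (x / n)) ^ 2 := by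
  set T := Icc 2 R with hT
  set P : ℕ → ℝ := fun y => ∏ q ∈ (y.minFac + 1).primesBelow, (1 - 1 / (q : ℝ))⁻¹ with hP
  have hS1 : ∀ x ∈ S, 1 ≤ x := fun x hx => (Finset.mem_Icc.1 (hS hx)).1
  have hST : ∀ x ∈ S, ∀ y ∈ pathSet x, y ∈ T := by
    intro x hx y hy
    have hb := mem_pathSet_bounds hy
    exact Finset.mem_Icc.2 ⟨hb.1, hb.2.trans (Finset.mem_Icc.1 (hS hx)).2⟩
  have hT2 : ∀ y ∈ T, 2 ≤ y := fun y hy => (Finset.mem_Icc.1 hy).1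
  have hJ : ∀ y ∈ T, ∑ x ∈ S.filter (fun x => y ∈ pathSet x), (1 / (x : ℝ)) ≤ (1 / (y : ℝ)) * P y := by
    intro y hy
    refine le_trans ?_ (sum_inv_path_users_le (M := R) (y := y) (by have := hT2 y hy; omega))
    refine Finset.sum_le_sum_of_subset_of_nonneg ?_ fun x _ _ => by positivity
    intro x hx
    obtain ⟨hxS, hyx⟩ := Finset.mem_filter.1 hx
    exact Finset.mem_filter.2 ⟨hS hxS, mem_pathSet hyx⟩
  have h := functional_sq_le_of_loads S T hS1 hST hT2 P hJ g
  have hDle : ∑ y ∈ T, (1 / (y : ℝ)) * ∑ n ∈ y.divisors, (vonMangoldt n : ℝ) * (g y - g (y / n)) ^ 2 ≤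
      ∑ x ∈ Icc 1 R, (1 / (x : ℝ)) * ∑ n ∈ x.divisors, (vonMangoldt n : ℝ) * (g x - g (x / n)) ^ 2 :=
    Finset.sum_le_sum_of_subset_of_nonneg (fun y hy => by
        have := Finset.mem_Icc.1 hy; exact Finset.mem_Icc.2 ⟨by omega, this.2⟩)
      fun x _ _ => mul_nonneg (by positivity) (Finset.sum_nonneg fun n _ =>
        mul_nonneg ArithmeticFunction.vonMangoldt_nonneg (sq_nonneg _))
  have hD0 : 0 ≤ ∑ y ∈ T, (1 / (y : ℝ)) * ∑ n ∈ y.divisors, (vonMangoldt n : ℝ) * (g y - g (y / n)) ^ 2 :=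
    Finset.sum_nonneg fun y _ => mul_nonneg (by positivity) (Finset.sum_nonneg fun n _ =>
      mul_nonneg ArithmeticFunction.vonMangoldt_nonneg (sq_nonneg _))
  have hE0 : 0 ≤ Real.exp 10 * (Real.log R + Real.log 4 +
      Real.exp 5 * Real.log ((R : ℝ) + 1) * (Real.log (Real.log R) + 4)) :=
    le_trans (Finset.sum_nonneg fun y hy => by
      have hy2 := (Finset.mem_Icc.1 hy).1
      have : 0 < Real.log y.minFac := Real.log_pos (by exact_mod_cast (Nat.minFac_prime (by omega)).one_lt)
      positivity) (rootEnergy_le hR)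
  exact h.trans (mul_le_mul (rootEnergy_le hR) hDle hD0 hE0)

/-- **PROP. K for an arbitrary user set inside an atom**: for `2 ≤ R`, every `N`, every
`S ⊆ 𝒜 = {x ≤ R : x N-smooth}` and `g`, `(Σ_{x∈S}(1/x)(g x − g 1))² ≤ E_K(R)·D_𝒜(g)` (the atom is closed under the
smallest-prime path, so the tree flow to `S` stays inside `𝒜`). -/
theorem subset_root_functional_sq_le_smooth {R : ℕ} (hR : 2 ≤ R) (N : ℕ) {S : Finset ℕ}
    (hS : S ⊆ (Icc 1 R).filter (· ∈ Nat.smoothNumbers N)) (g : ℕ → ℝ) :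
    (∑ x ∈ S, (1 / (x : ℝ)) * (g x - g 1)) ^ 2 ≤
      Real.exp 10 * (Real.log R + Real.log 4 + Real.exp 5 * Real.log ((R : ℝ) + 1) * (Real.log (Real.log R) + 4)) *
        ∑ x ∈ (Icc 1 R).filter (· ∈ Nat.smoothNumbers N),
          (1 / (x : ℝ)) * ∑ n ∈ x.divisors, (vonMangoldt n : ℝ) * (g x - g (x / n)) ^ 2 := by
  set A := (Icc 1 R).filter (· ∈ Nat.smoothNumbers N) with hA
  set T := A.filter (2 ≤ ·) with hT
  set P : ℕ → ℝ := fun y => ∏ q ∈ (y.minFac + 1).primesBelow, (1 - 1 / (q : ℝ))⁻¹ with hP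
  have hS1 : ∀ x ∈ S, 1 ≤ x := fun x hx => (Finset.mem_Icc.1 (Finset.mem_filter.1 (hS hx)).1).1
  have hST : ∀ x ∈ S, ∀ y ∈ pathSet x, y ∈ T := by
    intro x hx y hy
    have hxA := Finset.mem_filter.1 (hS hx)
    have hb := mem_pathSet_bounds hy
    refine Finset.mem_filter.2 ⟨Finset.mem_filter.2 ⟨Finset.mem_Icc.2 ⟨by omega, ?_⟩, ?_⟩, hb.1⟩
    · exact hb.2.trans (Finset.mem_Icc.1 hxA.1).2
    · exact mem_smoothNumbers_of_mem_pathSet hxA.2 hy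
  have hT2 : ∀ y ∈ T, 2 ≤ y := fun y hy => (Finset.mem_filter.1 hy).2
  have hJ : ∀ y ∈ T, ∑ x ∈ S.filter (fun x => y ∈ pathSet x), (1 / (x : ℝ)) ≤ (1 / (y : ℝ)) * P y := by
    intro y hy
    refine le_trans ?_ (sum_inv_path_users_le (M := R) (y := y) (by have := hT2 y hy; omega))
    refine Finset.sum_le_sum_of_subset_of_nonneg ?_ fun x _ _ => by positivity
    intro x hx
    obtain ⟨hxS, hyx⟩ := Finset.mem_filter.1 hx
    exact Finset.mem_filter.2 ⟨(Finset.mem_filter.1 (hS hxS)).1, mem_pathSet hyx⟩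
  have h := functional_sq_le_of_loads S T hS1 hST hT2 P hJ g
  have hE : ∑ y ∈ T, P y ^ 2 / ((y : ℝ) * Real.log y.minFac) ≤
      ∑ y ∈ Icc 2 R, P y ^ 2 / ((y : ℝ) * Real.log y.minFac) := by
    refine Finset.sum_le_sum_of_subset_of_nonneg ?_ fun y hy _ => ?_
    · intro y hy
      have hy' := Finset.mem_filter.1 hy
      have hy1 := Finset.mem_Icc.1 (Finset.mem_filter.1 hy'.1).1
      exact Finset.mem_Icc.2 ⟨hy'.2, hy1.2⟩
    · have hy2 := (Finset.mem_Icc.1 hy).1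
      have : 0 < Real.log y.minFac :=
        Real.log_pos (by exact_mod_cast (Nat.minFac_prime (by omega)).one_lt)
      positivity
  have hDle : ∑ y ∈ T, (1 / (y : ℝ)) * ∑ n ∈ y.divisors, (vonMangoldt n : ℝ) * (g y - g (y / n)) ^ 2 ≤
      ∑ x ∈ A, (1 / (x : ℝ)) * ∑ n ∈ x.divisors, (vonMangoldt n : ℝ) * (g x - g (x / n)) ^ 2 :=
    Finset.sum_le_sum_of_subset_of_nonneg (Finset.filter_subset _ _)
      fun x _ _ => mul_nonneg (by positivity) (Finset.sum_nonneg fun n _ =>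
        mul_nonneg ArithmeticFunction.vonMangoldt_nonneg (sq_nonneg _))
  have hD0 : 0 ≤ ∑ y ∈ T, (1 / (y : ℝ)) * ∑ n ∈ y.divisors, (vonMangoldt n : ℝ) * (g y - g (y / n)) ^ 2 :=
    Finset.sum_nonneg fun y _ => mul_nonneg (by positivity) (Finset.sum_nonneg fun n _ =>
      mul_nonneg ArithmeticFunction.vonMangoldt_nonneg (sq_nonneg _))
  have hE0 : 0 ≤ Real.exp 10 * (Real.log R + Real.log 4 +
      Real.exp 5 * Real.log ((R : ℝ) + 1) * (Real.log (Real.log R) + 4)) :=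
    le_trans (Finset.sum_nonneg fun y hy => by
      have hy2 := (Finset.mem_Icc.1 hy).1
      have : 0 < Real.log y.minFac := Real.log_pos (by exact_mod_cast (Nat.minFac_prime (by omega)).one_lt)
      positivity) (rootEnergy_le hR)
  exact h.trans (mul_le_mul (hE.trans (rootEnergy_le hR)) hDle hD0 hE0)

end Summit.RiemannHypothesis.RiemannHypothesis.Theorems.IntegerScrew

end
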